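import Literature.AnabelianGeometry.SemiGraphs.PSCCoveringMapAlongProofs
import Literature.AnabelianGeometry.SemiGraphs.PSCCoveringDatumRamificationProofs
import Literature.AnabelianGeometry.SemiGraphs.PSCCoveringBranchData
import Literature.AnabelianGeometry.SemiGraphs.PSCCompactificationTransfer
import Literature.AnabelianGeometry.SemiGraphs.PSCUnrTransportProofs
import Literature.AnabelianGeometry.SemiGraphs.ProSigmaSubquotients
import Literature.AnabelianGeometry.AbsoluteAnabelian.LocalReciprocityCofinal
import HarnessLib

/-!
# The kernel of `Π_{G_U} ↠ Π^unr` of the pro-l shadow, and its transport ([CombGC] Thm. 1.6 (iii), general `Σ`)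

Mochizuki, *A combinatorial version of the Grothendieck conjecture*, Tohoku Math. J. **59** (2007)
[CombGC], proof of Thm. 1.6, author's ms p. 13 l.−8…−4 ("we may assume that `Σ = {l}`") and (iii) p. 14;
row T16-L04c «(iii) general Σ» of the abc-iut sub-DAG `plan/L3/SUBDAG-CombGC-Thm16.md` (lineage
abc-iut-w4-d052).  For a `Π^unr_G`-covering datum `E` on a level `U ⊇ Ker(Π_G ↠ Π^unr_G)` (e.g.
`G.restrictBD U hU bd`), a presentation `g : U ↠ Q` of the maximal pro-`l` quotient (abc-iut-L3-t4's
`IsMaxProSigmaQuotient`) and the SHADOW `D := E.mapAlong g`, the composite `φ : U ↠ Q ↠ Q / Ker(Q ↠ Π^unr_D)`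
presents the maximal pro-`l` quotient of `Π^unr_{G_U} = U / Ker`.  Proved here: `mapAlong_unrKer`
(`Ker(Q ↠ Π^unr_D) = g(Ker(U ↠ Π^unr_E))`), `ker_mk_comp_eq` (`ker φ = Ker ⊔ ker g`),
`map_subtype_ker_eq_iInf` (`(ker φ)↑ = ⋂ {V | Ker ⊆ V ⊆ U, V ⊴ U, V open, [U : V] an l-power}`, the
family written out as a conjunction — no definition introduced), `iInf_level_family_normal` (normal in
`Π_G`), `unrTransport_iInf_level_family` / `unrTransport_map_subtype_ker` (the transport along ANY
`β : Π^unr_G ⥲ Π^unr_H` carries it onto the same object for `(H, β U)`: abc-iut-w5-d174's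
`relIndex_unrTransport`, abc-iut-L5-t6's `isOpen_unrTransport`) — the input of
`PSCUnrShadowEquiv.exists_equiv_over_unrTransport` / `ker_iff_of_unrTransport_map_ker`.  Proof-only,
0 defs; nothing here takes a side on [IUTchIII] Cor. 3.12. [cite: MochizukiCombGC2007, Thm 1.6(iii) p.13]
-/

namespace Literature.AnabelianGeometry.SemiGraphs

open scoped Pointwise
open Literature.AnabelianGeometry.Anabelioids (IsSigmaInteger)

universe u

namespace PSCDatum

/-! ### 1. `Ker(Q ↠ Π^unr)` of an image datum and the kernel of `U ↠ Q ↠ Q/Ker` -/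

section Image

variable {A : Type u} [Group A] [TopologicalSpace A] [IsTopologicalGroup A] [CompactSpace A]
variable {Q : Type u} [Group Q] [TopologicalSpace Q] [IsTopologicalGroup Q] [T2Space Q]
variable (E : PSCDatum A) (f : A →* Q) (hf : Continuous f) (hs : Function.Surjective f)
  (S : Set ℕ) (hS : S ⊆ E.Sigma) (hne : S.Nonempty) (hQ : IsProSigma S Q)

include hs in
/-- **`Ker(Q ↠ Π^unr)` of the image datum along a continuous surjection `f : Π ↠ Q`** (`Π` compact, `Q`
Hausdorff) is the image of `Ker(Π ↠ Π^unr)`. [cite: MochizukiCombGC2007, Def 1.1(ii) p.7] -/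
theorem mapAlong_unrKer : (E.mapAlong f hf S hS hne hQ).unrKer = E.unrKer.map f := by
  unfold unrKer
  rw [map_topologicalClosure_eq_of_isClosedMap f hf hf.isClosedMap, Subgroup.map_normalClosure _ _ hs,
    Set.image_union, Set.image_iUnion, Set.image_iUnion]
  rfl

include hs in
/-- **The kernel of `Π ↠ Q ↠ Q / Ker(Q ↠ Π^unr of the image datum)` is `Ker(Π ↠ Π^unr) ⊔ ker f`.**
[cite: MochizukiCombGC2007, Def 1.1(ii) p.7] -/
theorem ker_mk_comp_eq :
    ((QuotientGroup.mk' (E.mapAlong f hf S hS hne hQ).unrKer).comp f).ker = E.unrKer ⊔ f.ker := by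
  rw [← MonoidHom.comap_ker, QuotientGroup.ker_mk', E.mapAlong_unrKer f hf hs S hS hne hQ,
    Subgroup.comap_map_eq]

end Image

/-! ### 2. The level family `{V | Ker ⊆ V ⊆ U, V ⊴ U, open, [U : V] an l-power}` in `Π_G` -/

section Family

variable {P : Type u} [Group P] [TopologicalSpace P] [IsTopologicalGroup P]
variable (G : PSCDatum P) (U : Subgroup P) (l : ℕ)

omit [TopologicalSpace P] [IsTopologicalGroup P] in
/-- A conjugate subgroup, as a set, is the image under `x ↦ q x q⁻¹`. [cite: MochizukiCombGC2007, Def 1.1(ii) p.6] -/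
theorem coe_conjAct_smul (q : P) (V : Subgroup P) :
    ((ConjAct.toConjAct q • V : Subgroup P) : Set P) = (fun x => q * x * q⁻¹) '' (V : Set P) := by
  ext x
  simp only [SetLike.mem_coe, Subgroup.mem_smul_pointwise_iff_exists, ConjAct.smul_def,
    ConjAct.ofConjAct_toConjAct, Set.mem_image]

/-- A conjugate of an open subgroup is open. [cite: MochizukiCombGC2007, Def 1.1(ii) p.6] -/
theorem isOpen_conjAct_smul (q : P) {V : Subgroup P}
    (hV : IsOpen (V : Set P)) : IsOpen ((ConjAct.toConjAct q • V : Subgroup P) : Set P) := by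
  rw [coe_conjAct_smul]
  have : (fun x => q * x * q⁻¹) '' (V : Set P) = (fun x => q⁻¹ * x * q) ⁻¹' (V : Set P) := by
    ext x
    simp only [Set.mem_image, Set.mem_preimage, SetLike.mem_coe]
    constructor
    · rintro ⟨s, hs, rfl⟩
      simpa [mul_assoc] using hs
    · intro hx
      exact ⟨_, hx, by group⟩
  rw [this]
  exact hV.preimage ((continuous_const.mul continuous_id).mul continuous_const)

omit [TopologicalSpace P] [IsTopologicalGroup P] in
/-- Relative indices are invariant under conjugation. [cite: MochizukiCombGC2007, Def 1.1(ii) p.6] -/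
theorem relIndex_conjAct_smul (q : P) (V W : Subgroup P) :
    (ConjAct.toConjAct q • V).relIndex (ConjAct.toConjAct q • W) = V.relIndex W := by
  rw [Subgroup.pointwise_smul_def, Subgroup.pointwise_smul_def]
  exact Subgroup.relIndex_map_map_of_injective _ _ (MulAut.conj q).injective

/-- **The level family is stable under conjugation by `Π_G`** (`U ⊴ Π_G`): if `Ker ⊆ V ⊆ U`, `V ⊴ U`,
`[U : V]` an `l`-power, the same holds for `q V q⁻¹`. [cite: MochizukiCombGC2007, Def 1.1(ii) p.6] -/
theorem level_family_conj [U.Normal] (q : P) {V : Subgroup P}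
    (hK : G.unrKer ≤ V) (hVU : V ≤ U) (hn : ∀ u ∈ U, ∀ v ∈ V, u * v * u⁻¹ ∈ V)
    (hi : IsSigmaInteger {l} (V.relIndex U)) :
    G.unrKer ≤ ConjAct.toConjAct q • V ∧ ConjAct.toConjAct q • V ≤ U ∧
      (∀ u ∈ U, ∀ v ∈ ConjAct.toConjAct q • V, u * v * u⁻¹ ∈ ConjAct.toConjAct q • V) ∧
      IsSigmaInteger {l} ((ConjAct.toConjAct q • V).relIndex U) := by
  refine ⟨?_, ?_, ?_, ?_⟩
  · rw [← Subgroup.Normal.conjAct G.unrKer_normal (ConjAct.toConjAct q)]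
    exact Subgroup.pointwise_smul_le_pointwise_smul_iff.mpr hK
  · rw [← Subgroup.Normal.conjAct (inferInstance : U.Normal) (ConjAct.toConjAct q)]
    exact Subgroup.pointwise_smul_le_pointwise_smul_iff.mpr hVU
  · intro u hu v hv
    obtain ⟨w, hw, rfl⟩ := (Subgroup.mem_smul_pointwise_iff_exists _ _ _).mp hv
    refine (Subgroup.mem_smul_pointwise_iff_exists _ _ _).mpr ⟨(q⁻¹ * u * q) * w * (q⁻¹ * u * q)⁻¹,
      hn _ (by simpa [mul_assoc] using (inferInstance : U.Normal).conj_mem' u hu q) w hw, ?_⟩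
    simp only [ConjAct.smul_def, ConjAct.ofConjAct_toConjAct]
    group
  · rw [← Subgroup.Normal.conjAct (inferInstance : U.Normal) (ConjAct.toConjAct q), relIndex_conjAct_smul]
    exact hi

/-- An open `U ⊇ Ker(Π_G ↠ Π^unr_G)` belongs to its own level family. [cite: MochizukiCombGC2007, Def 1.1(ii) p.6] -/
theorem self_mem_level_family (hKU : G.unrKer ≤ U) (hU : IsOpen (U : Set P)) :
    G.unrKer ≤ U ∧ U ≤ U ∧ (∀ u ∈ U, ∀ v ∈ U, u * v * u⁻¹ ∈ U) ∧ IsOpen (U : Set P) ∧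
      IsSigmaInteger {l} (U.relIndex U) :=
  ⟨hKU, le_rfl, fun u hu v hv => U.mul_mem (U.mul_mem hu hv) (U.inv_mem hu), hU,
    by rw [Subgroup.relIndex_self]; exact IsSigmaInteger.one _⟩

/-- **The intersection of the level family is a normal subgroup of `Π_G`.** [cite: MochizukiCombGC2007, Def 1.1(ii) p.6] -/
theorem iInf_level_family_normal [U.Normal] :
    (⨅ V : {V : Subgroup P // G.unrKer ≤ V ∧ V ≤ U ∧ (∀ u ∈ U, ∀ v ∈ V, u * v * u⁻¹ ∈ V) ∧
        IsOpen (V : Set P) ∧ IsSigmaInteger {l} (V.relIndex U)}, (V : Subgroup P)).Normal := by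
  refine ⟨fun n hn q => ?_⟩
  rw [Subgroup.mem_iInf] at hn ⊢
  rintro ⟨V, hK, hVU, hnorm, ho, hi⟩
  -- `q⁻¹ V q` is again in the family, so `n` lies in it
  obtain ⟨hK', hVU', hnorm', hi'⟩ := G.level_family_conj U l q⁻¹ hK hVU hnorm hi
  have ho' := isOpen_conjAct_smul q⁻¹ ho
  have hn' := hn ⟨_, hK', hVU', hnorm', ho', hi'⟩
  obtain ⟨w, hw, hnw⟩ := (Subgroup.mem_smul_pointwise_iff_exists _ _ _).mp hn'
  simp only [ConjAct.smul_def, ConjAct.ofConjAct_toConjAct] at hnw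
  rw [← hnw]
  simpa [mul_assoc] using hw

end Family

/-! ### 3. The kernel at a `Π^unr_G`-covering, pushed into `Π_G`, is the intersection of the family -/

section Level

variable {P : Type u} [Group P] [TopologicalSpace P] [IsTopologicalGroup P]
variable (G : PSCDatum P) (U : Subgroup P) [CompactSpace U]
  (hU : IsOpen (U : Set P)) (hKU : G.unrKer ≤ U) (E : PSCDatum U)
  (hE : E.unrKer.map U.subtype = G.unrKer)
variable {Q : Type u} [Group Q] [TopologicalSpace Q] [IsTopologicalGroup Q] [CompactSpace Q]
  [TotallyDisconnectedSpace Q] [T2Space Q]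
variable {l : ℕ} (hSl : ({l} : Set ℕ) ⊆ E.Sigma) {g : U →* Q} (hg : IsMaxProSigmaQuotient {l} g)

include hU hKU hE hg in
/-- **The kernel of `U ↠ Q ↠ Q/Ker(Q ↠ Π^unr of the shadow)`, pushed into `Π_G`, is the
intersection of the level family** `{V | Ker ⊆ V ⊆ U, V ⊴ U, V open, [U : V] an l-power}` ("⊆": the kernel
is `Ker · ker g`, `ker g` below every open normal `l`-power-index subgroup; "⊇": `Q/Ker` is pro-`l`
profinite); for ANY datum `E` on `U` with `Ker(U ↠ Π^unr_E)↑ = Ker(Π_G ↠ Π^unr_G)` (e.g. `G.restrictBD U hU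
bd`, abc-iut-w5-d174's `unrKer_restrict`). [cite: MochizukiCombGC2007, Thm 1.6(iii) p.13] -/
theorem map_subtype_ker_eq_iInf :
    (((QuotientGroup.mk' (E.mapAlong g hg.continuous {l} hSl (Set.singleton_nonempty l)
        hg.proSigma).unrKer).comp g).ker).map U.subtype =
      ⨅ V : {V : Subgroup P // G.unrKer ≤ V ∧ V ≤ U ∧ (∀ u ∈ U, ∀ v ∈ V, u * v * u⁻¹ ∈ V) ∧
        IsOpen (V : Set P) ∧ IsSigmaInteger {l} (V.relIndex U)}, (V : Subgroup P) := by
  set D := E.mapAlong g hg.continuous {l} hSl (Set.singleton_nonempty l) hg.proSigma with hD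
  have hker : ((QuotientGroup.mk' D.unrKer).comp g).ker = E.unrKer ⊔ g.ker := by
    rw [hD]; exact E.ker_mk_comp_eq g hg.continuous hg.surjective {l} _ _ hg.proSigma
  apply le_antisymm
  · -- `⊆`: below every member of the family
    refine le_iInf fun V => ?_
    obtain ⟨V, hK, hVU, hnorm, ho, hi⟩ := V
    rw [hker, Subgroup.map_sup, hE]
    refine sup_le hK ?_
    -- `ker g ⊆ V ∩ U`, an open normal subgroup of `U` of `l`-power index
    haveI hVn : (V.subgroupOf U).Normal := by
      rw [Subgroup.normal_subgroupOf_iff_le_normalizer hVU]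
      intro u hu
      rw [Subgroup.mem_normalizer_iff]
      intro v
      constructor
      · intro hv; exact hnorm u hu v hv
      · intro hv
        have := hnorm u⁻¹ (U.inv_mem hu) _ hv
        simpa [mul_assoc] using this
    have hVo : IsOpen ((V.subgroupOf U : Subgroup U) : Set U) := ho.preimage continuous_subtype_val
    have hVi : IsSigmaInteger {l} (V.subgroupOf U).index := hi
    have hle : g.ker ≤ V.subgroupOf U := hg.ker_le _ hVn hVo hVi
    calc g.ker.map U.subtype ≤ (V.subgroupOf U).map U.subtype := Subgroup.map_mono hle
      _ ≤ V := by rw [Subgroup.subgroupOf_map_subtype]; exact inf_le_left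
  · -- `⊇`: an element of the intersection lies in `U`; if `φ x ≠ 1`, an open normal subgroup of the
    -- pro-`l` profinite group `Q / Ker` missing `φ x` pulls back to a member of the family avoiding `x`
    intro x hx
    have hxU : x ∈ U := (Subgroup.mem_iInf.mp hx) ⟨U, G.self_mem_level_family U l hKU hU⟩
    refine ⟨⟨x, hxU⟩, ?_, rfl⟩
    -- notation: `N = Ker(Q ↠ Π^unr_D)`, `φ = (Q ↠ Q/N) ∘ g`
    set N := D.unrKer with hN
    have hNc : IsClosed (N : Set Q) := Subgroup.isClosed_topologicalClosure _
    change ((QuotientGroup.mk' N).comp g) ⟨x, hxU⟩ = 1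
    by_contra hne
    haveI : TotallyDisconnectedSpace (Q ⧸ N) :=
      AbsoluteAnabelian.QuotientGroup.totallyDisconnectedSpace_of_isClosed _ hNc
    have hproL : IsProSigma {l} (Q ⧸ N) := hg.proSigma.quotient _
    obtain ⟨O, hO⟩ := ProfiniteGrp.exist_openNormalSubgroup_sub_open_nhds_of_one
      (isOpen_compl_singleton (x := ((QuotientGroup.mk' N).comp g) ⟨x, hxU⟩)) (by simpa using Ne.symm hne)
    have hφx : ((QuotientGroup.mk' N).comp g) ⟨x, hxU⟩ ∉ (O : Set (Q ⧸ N)) := fun h => hO h rfl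
    -- the pullback `W = φ⁻¹(O)` and its image `V` in `Π_G`
    have hφc : Continuous ((QuotientGroup.mk' N).comp g) := QuotientGroup.continuous_mk.comp hg.continuous
    have hφs : Function.Surjective ((QuotientGroup.mk' N).comp g) :=
      (QuotientGroup.mk'_surjective _).comp hg.surjective
    haveI hWn : (O.toSubgroup.comap ((QuotientGroup.mk' N).comp g)).Normal := Subgroup.normal_comap _
    have hWo : IsOpen ((O.toSubgroup.comap ((QuotientGroup.mk' N).comp g) : Subgroup U) : Set U) :=
      O.isOpen'.preimage hφc
    have hWi : IsSigmaInteger {l} (O.toSubgroup.comap ((QuotientGroup.mk' N).comp g)).index := by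
      rw [Subgroup.index_comap_of_surjective _ hφs]
      exact hproL.isSigmaInteger_index _ O.isOpen'
    have hVU : (O.toSubgroup.comap ((QuotientGroup.mk' N).comp g)).map U.subtype ≤ U :=
      Subgroup.map_subtype_le _
    have hKV : G.unrKer ≤ (O.toSubgroup.comap ((QuotientGroup.mk' N).comp g)).map U.subtype := by
      rw [← hE]
      refine Subgroup.map_mono ?_
      intro k hk
      rw [Subgroup.mem_comap]
      have : ((QuotientGroup.mk' N).comp g) k = 1 := by
        rw [← MonoidHom.mem_ker, hker]; exact Subgroup.mem_sup_left hk
      rw [this]; exact O.toSubgroup.one_mem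
    have hnorm : ∀ u ∈ U, ∀ v ∈ (O.toSubgroup.comap ((QuotientGroup.mk' N).comp g)).map U.subtype,
        u * v * u⁻¹ ∈ (O.toSubgroup.comap ((QuotientGroup.mk' N).comp g)).map U.subtype := by
      intro u hu v hv
      obtain ⟨w, hw, rfl⟩ := hv
      exact ⟨⟨u, hu⟩ * w * ⟨u, hu⟩⁻¹, hWn.conj_mem w hw ⟨u, hu⟩, rfl⟩
    have hVo : IsOpen (((O.toSubgroup.comap ((QuotientGroup.mk' N).comp g)).map U.subtype : Subgroup P) :
        Set P) := by
      rw [Subgroup.coe_map, Subgroup.coe_subtype]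
      exact hU.isOpenMap_subtype_val _ hWo
    have hVi : IsSigmaInteger {l}
        (((O.toSubgroup.comap ((QuotientGroup.mk' N).comp g)).map U.subtype).relIndex U) := by
      have hcm : ((O.toSubgroup.comap ((QuotientGroup.mk' N).comp g)).map U.subtype).subgroupOf U =
          O.toSubgroup.comap ((QuotientGroup.mk' N).comp g) :=
        Subgroup.comap_map_eq_self_of_injective U.subtype_injective _
      rw [Subgroup.relIndex, hcm]
      exact hWi
    have hxV := (Subgroup.mem_iInf.mp hx) ⟨_, hKV, hVU, hnorm, hVo, hVi⟩
    obtain ⟨w, hw, hwx⟩ := hxV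
    have hw' : w = ⟨x, hxU⟩ := Subtype.ext hwx
    rw [hw'] at hw
    exact hφx hw

include hE hg in
omit [CompactSpace Q] [TotallyDisconnectedSpace Q] in
/-- The kernel pushed into `Π_G` contains `Ker(Π_G ↠ Π^unr_G)`. [cite: MochizukiCombGC2007, Def 1.1(ii) p.7] -/
theorem unrKer_le_map_subtype_ker :
    G.unrKer ≤ (((QuotientGroup.mk' (E.mapAlong g hg.continuous {l} hSl (Set.singleton_nonempty l)
        hg.proSigma).unrKer).comp g).ker).map U.subtype := by
  rw [E.ker_mk_comp_eq g hg.continuous hg.surjective {l} _ _ hg.proSigma, Subgroup.map_sup, hE]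
  exact le_sup_left

end Level

/-! ### 4. The transport carries the intersection of the family for `(G, U)` onto that for `(H, β U)` -/

section Transport

variable {P : Type u} [Group P] [TopologicalSpace P] [IsTopologicalGroup P]
variable {P' : Type u} [Group P'] [TopologicalSpace P'] [IsTopologicalGroup P']
variable (G : PSCDatum P) (H : PSCDatum P') (β : (P ⧸ G.unrKer) ≃ₜ* (P' ⧸ H.unrKer))

/-- The transport of an intersection of subgroups containing the kernel is the intersection of the
transports (nonempty family). [cite: MochizukiCombGC2007, Def 1.4(iii) p.10] -/
theorem unrTransport_iInf {ι : Sort*} [Nonempty ι] (V : ι → Subgroup P) (hV : ∀ i, G.unrKer ≤ V i) :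
    G.unrTransport H β (⨅ i, V i) = ⨅ i, G.unrTransport H β (V i) := by
  apply le_antisymm
  · exact le_iInf fun i => G.unrTransport_mono H β (iInf_le V i)
  · intro y hy
    rw [Subgroup.mem_iInf] at hy
    obtain ⟨i₀⟩ := ‹Nonempty ι›
    obtain ⟨s, hs, hsy⟩ := (G.mem_unrTransport_iff H β).mp (hy i₀)
    refine (G.mem_unrTransport_iff H β).mpr ⟨s, Subgroup.mem_iInf.mpr fun i => ?_, hsy⟩
    obtain ⟨t, ht, hty⟩ := (G.mem_unrTransport_iff H β).mp (hy i)
    have hst : (QuotientGroup.mk t : P ⧸ G.unrKer) = QuotientGroup.mk s :=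
      β.injective (hty.trans hsy.symm)
    rw [QuotientGroup.eq] at hst
    have : s = t * (t⁻¹ * s) := by group
    rw [this]
    exact (V i).mul_mem ht (hV i hst)

/-- **Each defining property of the level family is carried by the transport**: for `V` in the family of
`(G, U)`, `β V` is in the family of `(H, β U)`. [cite: MochizukiCombGC2007, Def 1.4(iii) p.10] -/
theorem level_family_unrTransport {U V : Subgroup P} {l : ℕ}
    (hK : G.unrKer ≤ V) (hVU : V ≤ U) (hn : ∀ u ∈ U, ∀ v ∈ V, u * v * u⁻¹ ∈ V)
    (ho : IsOpen (V : Set P)) (hi : IsSigmaInteger {l} (V.relIndex U)) :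
    H.unrKer ≤ G.unrTransport H β V ∧ G.unrTransport H β V ≤ G.unrTransport H β U ∧
      (∀ u' ∈ G.unrTransport H β U, ∀ v' ∈ G.unrTransport H β V,
        u' * v' * u'⁻¹ ∈ G.unrTransport H β V) ∧
      IsOpen (G.unrTransport H β V : Set P') ∧
      IsSigmaInteger {l} ((G.unrTransport H β V).relIndex (G.unrTransport H β U)) := by
  refine ⟨G.unrKer_le_unrTransport H β V, G.unrTransport_mono H β hVU, ?_,
    G.isOpen_unrTransport H β ho, by rw [G.relIndex_unrTransport H β hK]; exact hi⟩
  intro u' hu' v' hv'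
  obtain ⟨u, hu, huu'⟩ := (G.mem_unrTransport_iff H β).mp hu'
  obtain ⟨v, hv, hvv'⟩ := (G.mem_unrTransport_iff H β).mp hv'
  refine (G.mem_unrTransport_iff H β).mpr ⟨u * v * u⁻¹, hn u hu v hv, ?_⟩
  simp only [QuotientGroup.mk_mul, QuotientGroup.mk_inv, map_mul, map_inv, huu', hvv']

/-- **The transport carries the intersection of the level family of `(G, U)` onto that of `(H, β U)`**
(`U ⊇ Ker(Π_G ↠ Π^unr_G)` open). [cite: MochizukiCombGC2007, Thm 1.6(iii) p.13] -/
theorem unrTransport_iInf_level_family {U : Subgroup P} (hKU : G.unrKer ≤ U) (hU : IsOpen (U : Set P))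
    (l : ℕ) :
    G.unrTransport H β
        (⨅ V : {V : Subgroup P // G.unrKer ≤ V ∧ V ≤ U ∧ (∀ u ∈ U, ∀ v ∈ V, u * v * u⁻¹ ∈ V) ∧
          IsOpen (V : Set P) ∧ IsSigmaInteger {l} (V.relIndex U)}, (V : Subgroup P)) =
      ⨅ V' : {V' : Subgroup P' // H.unrKer ≤ V' ∧ V' ≤ G.unrTransport H β U ∧
          (∀ u' ∈ G.unrTransport H β U, ∀ v' ∈ V', u' * v' * u'⁻¹ ∈ V') ∧
          IsOpen (V' : Set P') ∧ IsSigmaInteger {l} (V'.relIndex (G.unrTransport H β U))},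
        (V' : Subgroup P') := by
  haveI : Nonempty {V : Subgroup P // G.unrKer ≤ V ∧ V ≤ U ∧ (∀ u ∈ U, ∀ v ∈ V, u * v * u⁻¹ ∈ V) ∧
      IsOpen (V : Set P) ∧ IsSigmaInteger {l} (V.relIndex U)} := ⟨⟨U, G.self_mem_level_family U l hKU hU⟩⟩
  set U' := G.unrTransport H β U with hU'
  have hKU' : H.unrKer ≤ U' := G.unrKer_le_unrTransport H β U
  haveI : Nonempty {V' : Subgroup P' // H.unrKer ≤ V' ∧ V' ≤ U' ∧
      (∀ u' ∈ U', ∀ v' ∈ V', u' * v' * u'⁻¹ ∈ V') ∧ IsOpen (V' : Set P') ∧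
      IsSigmaInteger {l} (V'.relIndex U')} :=
    ⟨⟨U', H.self_mem_level_family U' l hKU' (G.isOpen_unrTransport H β hU)⟩⟩
  apply le_antisymm
  · -- `β(⋂ V) = ⋂ β V ≤ ⋂ V'` since each `V'` is `β V` for the member `V := β⁻¹ V'`
    rw [G.unrTransport_iInf H β _ (fun V => V.2.1)]
    refine le_iInf fun V' => ?_
    obtain ⟨V', hK', hV'U', hn', ho', hi'⟩ := V'
    obtain ⟨hK, hVU, hn, ho, hi⟩ := H.level_family_unrTransport G β.symm hK' hV'U' hn' ho' hi'
    rw [hU', G.unrTransport_symm_unrTransport H β hKU] at hVU hn hi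
    have hback : G.unrTransport H β (H.unrTransport G β.symm V') = V' :=
      G.unrTransport_unrTransport_symm H β hK'
    intro y hy
    have hy' := (Subgroup.mem_iInf.mp hy) ⟨H.unrTransport G β.symm V', hK, hVU, hn, ho, hi⟩
    rwa [hback] at hy'
  · -- `⋂ V' ≤ ⋂ β V`: each `β V`, `V` in the family, is a `V'`
    rw [G.unrTransport_iInf H β _ (fun V => V.2.1)]
    refine le_iInf fun V => ?_
    obtain ⟨V, hK, hVU, hn, ho, hi⟩ := V
    obtain ⟨hK', hV'U', hn', ho', hi'⟩ := G.level_family_unrTransport H β hK hVU hn ho hi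
    intro y hy
    exact (Subgroup.mem_iInf.mp hy) ⟨G.unrTransport H β V, hK', hV'U', hn', ho', hi'⟩

end Transport

/-! ### 5. The kernels on the two sides correspond under the transport -/

section TwoSides

variable {P : Type u} [Group P] [TopologicalSpace P] [IsTopologicalGroup P]
variable {P' : Type u} [Group P'] [TopologicalSpace P'] [IsTopologicalGroup P']
variable (G : PSCDatum P) (H : PSCDatum P') (β : (P ⧸ G.unrKer) ≃ₜ* (P' ⧸ H.unrKer))
variable {U : Subgroup P} [CompactSpace U] (hU : IsOpen (U : Set P)) (hKU : G.unrKer ≤ U)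
  (E : PSCDatum U) (hE : E.unrKer.map U.subtype = G.unrKer)
variable {U' : Subgroup P'} [CompactSpace U'] (hU' : IsOpen (U' : Set P'))
  (E' : PSCDatum U') (hE' : E'.unrKer.map U'.subtype = H.unrKer)
variable {Q : Type u} [Group Q] [TopologicalSpace Q] [IsTopologicalGroup Q] [CompactSpace Q]
  [TotallyDisconnectedSpace Q] [T2Space Q]
variable {Q' : Type u} [Group Q'] [TopologicalSpace Q'] [IsTopologicalGroup Q'] [CompactSpace Q']
  [TotallyDisconnectedSpace Q'] [T2Space Q']
variable {l : ℕ} (hSl : ({l} : Set ℕ) ⊆ E.Sigma) (hSl' : ({l} : Set ℕ) ⊆ E'.Sigma)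
  {g : U →* Q} (hg : IsMaxProSigmaQuotient {l} g) {g' : U' →* Q'} (hg' : IsMaxProSigmaQuotient {l} g')

include hU hKU hE hU' hE' hg hg' in
/-- **The transport along `β` carries the kernel of `U ↠ Q ↠ Q/Ker(Q ↠ Π^unr of the shadow of G_U)`,
pushed into `Π_G`, onto that of `U' ↠ Q' ↠ Q'/Ker(Q' ↠ Π^unr of the shadow of H_{U'})`** (`U' = β U`; any
data `E`, `E'` on the levels with the correct `Ker(· ↠ Π^unr)`, any presentations `g`, `g'`) — the input of
`PSCUnrShadowEquiv.ker_iff_of_unrTransport_map_ker`. [cite: MochizukiCombGC2007, Thm 1.6(iii) p.13] -/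
theorem unrTransport_map_subtype_ker (hUU' : G.unrTransport H β U = U') :
    G.unrTransport H β ((((QuotientGroup.mk' (E.mapAlong g hg.continuous {l} hSl
        (Set.singleton_nonempty l) hg.proSigma).unrKer).comp g).ker).map U.subtype) =
      (((QuotientGroup.mk' (E'.mapAlong g' hg'.continuous {l} hSl' (Set.singleton_nonempty l)
        hg'.proSigma).unrKer).comp g').ker).map U'.subtype := by
  have hKU' : H.unrKer ≤ U' := hUU' ▸ G.unrKer_le_unrTransport H β U
  rw [G.map_subtype_ker_eq_iInf U hU hKU E hE hSl hg, H.map_subtype_ker_eq_iInf U' hU' hKU' E' hE' hSl' hg',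
    G.unrTransport_iInf_level_family H β hKU hU l]
  subst hUU'
  rfl

include hKU in
omit [CompactSpace U] in
/-- `Ker(Π_{G_U} ↠ Π^unr_{G_U})↑ = Ker(Π_G ↠ Π^unr_G)` for `G_U = G.restrictBD U hU bd` (abc-iut-w5-d174's
`map_subtype_unrKer_restrict`): the hypothesis `hE` of this file. [cite: MochizukiCombGC2007, Def 1.1(ii) p.7] -/
theorem map_subtype_unrKer_restrictBD [U.FiniteIndex] (bd : G.BranchData) :
    ((G.restrictBD U hU bd).unrKer).map U.subtype = G.unrKer := by
  rw [restrictBD_unrKer]; exact G.map_subtype_unrKer_restrict U hU hKU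

end TwoSides

end PSCDatum

end Literature.AnabelianGeometry.SemiGraphs
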